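import Summits.SmoothPoincare4.SmoothPoincare4.Theorems.InformationMetricHadamardAhHadamardFillingStubHellingerGaussEquationLpFamily
import Summits.SmoothPoincare4.SmoothPoincare4.Theorems.InformationMetricHadamardAhHadamardFillingStubHellingerGaussEquationImmersion

/-!
# Stub `stub_hellingerGaussEquation` (K2) of line `fisher-sphere-gauss`
(crux `InformationMetricHadamard.AhHadamardFilling`, item stmt-SmoothPoincare4-6014)

**The Gauss equation of the Hellinger map.** For a jointly smooth family `θ : W → (N → ℝ)` over a
closed Riemannian 4-manifold `(N, g_N)` parametrised by a 5-manifold `W`, a metric `G` on `W`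
INDUCED by `w ↦ θ w ∈ L²(N, dvol_{g_N})` (`G.val = fisherForm`, stub I) and any Levi-Civita
connection `cov` of `G`: at every `w` and for all `X, Y ∈ T_w W` the normal parts
`h_XX, h_XY, h_YY` of the chart Hessian of `θ` (`IsNormalPart`) exist and
`Rm(X, Y, Y, X) = ⟨h_XX, h_YY⟩_{L²} − ‖h_XY‖²_{L²} = −saddleForm` (Gauss 1827; Lee, *Riemannian
Manifolds*, 2nd ed., Thm. 8.5, for an immersion into the flat Hilbert space `L²(N, dvol)`).

Proof (this file assembles the three helper files):
* `…LpFamily.lean`: `ι : w ↦ [θ w] ∈ V = L²(N, μ)`, `μ = dvol_{g_N}` (finite: `N` compact), is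
  `C^∞` with `dι_w X = [D1 θ w X]`, so `G = ι^*⟨·,·⟩` (`MeasureTheory.L2.inner_def`); the ambient
  derivative of `ι_*(extend B)` along `A` at `w` is `[D2 θ w B A]`;
* `…Immersion.lean`: the abstract Gauss equation `val_curvature_immersion` of an isometric
  immersion into a flat inner product space, symmetry (`sff_symm_immersion`) and normality
  (`inner_sff_mvfderiv_immersion`) of the second fundamental form
  `II(A, B) = D_A(ι_* extend B) − dι(∇_A extend B)`;
* hence `II(A, B) = [h(A, B)]` with the honest function
  `h(A, B) = D2 θ w B A − D1 θ w (∇_A extend B)`; `h_XY := h(Y, X)`, `h_XX := h(X, X)`,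
  `h_YY := h(Y, Y)` are normal parts (tangential defect `D1 θ w (∇ extend)`, orthogonality
  = normality of `II`), and `Rm(X,Y,Y,X) = ⟪II(Y,Y), II(X,X)⟫ − ⟪II(X,Y), II(Y,X)⟫ = −saddleForm`.
Authorship: stub-worker of the line lead prover-line-stmt-SmoothPoincare4-6014-c5-0 (wave 1).

References: J. M. Lee, *Introduction to Riemannian Manifolds* (2nd ed. 2018), Thm. 8.5;
D. Groisser, M. K. Murray, *Instantons and the information metric*, Ann. Global Anal. Geom. 15
(1997), dg-ga/9611008, §2 p. 5; S. Amari, H. Nagaoka, *Methods of Information Geometry*, §2.2.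
-/

noncomputable section

-- the prescribed namespace `Summit.<P>.<Sub>.…` duplicates `SmoothPoincare4` (P = Sub)
set_option linter.dupNamespace false

open scoped Manifold ContDiff Topology ENNReal NNReal RealInnerProductSpace
open Set Function MeasureTheory Topology Filter Bundle FiberBundle

namespace Summit.SmoothPoincare4.SmoothPoincare4.Cruxes.AhHadamardFilling.FisherSphereGauss

open Literature.Geometry.Lorentzian (PseudoRiemannianMetric riemannianMeasure)

/-- The algebra of the Gauss equation: `∫ c·a − ∫ b·b = −(∫ b² − ∫ a·c)`. [folklore] -/
theorem gauss_algebra {α : Type*} [MeasurableSpace α] {μ : Measure α} (a b c : α → ℝ) :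
    ∫ x, c x * a x ∂μ - ∫ x, b x * b x ∂μ = -(∫ x, b x ^ 2 ∂μ - ∫ x, a x * c x ∂μ) := by
  have e1 : (fun x ↦ b x ^ 2) = fun x ↦ b x * b x := funext fun x ↦ sq _
  have e2 : (fun x ↦ c x * a x) = fun x ↦ a x * c x := funext fun x ↦ mul_comm _ _
  rw [e1, e2]
  ring

section GaussFamily

variable {N : Type*} [TopologicalSpace N] [T2Space N] [CompactSpace N]
  [ChartedSpace (EuclideanSpace ℝ (Fin 4)) N] [IsManifold (𝓡 4) ∞ N]
  {W : Type*} [TopologicalSpace W] [ChartedSpace (EuclideanSpace ℝ (Fin 5)) W]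
  [IsManifold (𝓡 5) ∞ W] [MeasurableSpace N] [BorelSpace N] {μ : Measure N} [IsFiniteMeasure μ]

/-- **K2 for a family realised in `L²(N, μ)`.** If `gIntegral gN hgN = ∫ · dμ` for a finite Borel
measure `μ` on the compact `N` (for the stub: `μ = dvol_{g_N}` on the Borel σ-algebra), then for a
jointly smooth family `θ`, an induced metric `G` (`G.val = fisherForm`) and a Levi-Civita `cov`
of `G`, the honest representatives `h(A, B) = D2 θ w B A − D1 θ w (∇_A extend B)` of the second
fundamental form `II(A, B) = D_A(ι_* extend B) − dι(∇_A extend B)` of `ι : w ↦ [θ w]`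
(`contMDiff_toLp_family`, `mvfderiv_toLp_family`, `mvfderiv_extend_toLp_family`) give normal
parts `h(X,X)`, `h(Y,X)`, `h(Y,Y)` of the chart Hessian on `(X,X)`, `(X,Y)`, `(Y,Y)`
(tangential defect `D1 θ w (∇ extend)`; orthogonality = normality of `II`,
`inner_sff_mvfderiv_immersion`), and `Rm(X,Y,Y,X) = ⟪II(Y,Y), II(X,X)⟫ − ⟪II(X,Y), II(Y,X)⟫`
(`val_curvature_immersion`) `= −saddleForm` by the symmetry `sff_symm_immersion`.
[cite: LeeRiemannianManifolds2018, Thm 8.5] -/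
theorem gauss_toLp_family
    {gN : PseudoRiemannianMetric (𝓡 4) ∞ (EuclideanSpace ℝ (Fin 4)) (TangentSpace (𝓡 4) : N → Type _)}
    {hgN : gN.IsRiemannian} (hgi : ∀ f : N → ℝ, gIntegral gN hgN f = ∫ x, f x ∂μ)
    {θ : W → N → ℝ} (hθ : ContMDiff ((𝓡 5).prod (𝓡 4)) 𝓘(ℝ, ℝ) ∞ (fun p : W × N ↦ θ p.1 p.2))
    {G : PseudoRiemannianMetric (𝓡 5) ∞ (EuclideanSpace ℝ (Fin 5)) (TangentSpace (𝓡 5) : W → Type _)}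
    (hGθ : ∀ (w : W) (X Y : TangentSpace (𝓡 5) w), G.val w X Y = fisherForm gN hgN θ w X Y)
    {cov : CovariantDerivative (𝓡 5) (EuclideanSpace ℝ (Fin 5)) (TangentSpace (𝓡 5) : W → Type _)}
    (hcov : G.IsLeviCivita cov) (w : W) (X Y : TangentSpace (𝓡 5) w) :
    ∃ hXX hXY hYY : N → ℝ,
      IsNormalPart gN hgN θ w X X hXX ∧ IsNormalPart gN hgN θ w X Y hXY ∧
      IsNormalPart gN hgN θ w Y Y hYY ∧
      G.curvatureForm cov w X Y Y X = - saddleForm gN hgN hXX hXY hYY := by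
  have hθc : ∀ w, Continuous (θ w) := continuous_family hθ
  -- the map `ι : W → V = L²(N, μ)` and its first two derivatives
  obtain ⟨ι, hιeq⟩ : ∃ ι : W → Lp ℝ 2 μ,
      ι = fun w ↦ ContinuousMap.toLp (E := ℝ) 2 μ ℝ (⟨θ w, hθc w⟩ : C(N, ℝ)) := ⟨_, rfl⟩
  have hι : ContMDiff (𝓡 5) 𝓘(ℝ, Lp ℝ 2 μ) ∞ ι := by
    rw [hιeq]; exact contMDiff_toLp_family hθ hθc
  have hd : ∀ (y : W) (v : TangentSpace (𝓡 5) y), mvfderiv (𝓡 5) ι y v =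
      ContinuousMap.toLp (E := ℝ) 2 μ ℝ ⟨fun x ↦ D1 θ y v x, continuous_D1 hθ y v⟩ := by
    intro y v; rw [hιeq]; exact mvfderiv_toLp_family hθ hθc y v fun x ↦ rfl
  have hdd : ∀ A B : TangentSpace (𝓡 5) w,
      mvfderiv (𝓡 5) (fun y ↦ mvfderiv (𝓡 5) ι y (extend (EuclideanSpace ℝ (Fin 5)) B y))
          w A =
        ContinuousMap.toLp (E := ℝ) 2 μ ℝ ⟨fun x ↦ D2 θ w B A x, continuous_D2 hθ w B A⟩ := by
    intro A B; rw [hιeq]; exact mvfderiv_extend_toLp_family hθ hθc w A B fun x ↦ rfl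
  -- `G` is induced by `ι`
  have hg : ∀ (y : W) (v v' : TangentSpace (𝓡 5) y),
      G.val y v v' = ⟪mvfderiv (𝓡 5) ι y v, mvfderiv (𝓡 5) ι y v'⟫ := by
    intro y v v'
    rw [hGθ, hd, hd, inner_toLp_toLp]
    simp only [ContinuousMap.coe_mk, fisherForm, hgi]
  -- the honest representatives `h A B` of the second fundamental form vectors `II(A, B)`
  obtain ⟨h, hh⟩ : ∃ h : TangentSpace (𝓡 5) w → TangentSpace (𝓡 5) w → N → ℝ, ∀ A B x,
      h A B x = D2 θ w B A x - D1 θ w (cov (extend (EuclideanSpace ℝ (Fin 5)) B) w A) x :=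
    ⟨fun A B x ↦ D2 θ w B A x - D1 θ w (cov (extend (EuclideanSpace ℝ (Fin 5)) B) w A) x,
      fun _ _ _ ↦ rfl⟩
  have hc : ∀ A B, Continuous (h A B) := by
    intro A B
    rw [show h A B = _ from funext (hh A B)]
    exact (continuous_D2 hθ w B A).sub (continuous_D1 hθ w _)
  have hNv : ∀ A B : TangentSpace (𝓡 5) w,
      mvfderiv (𝓡 5) (fun y ↦ mvfderiv (𝓡 5) ι y (extend (EuclideanSpace ℝ (Fin 5)) B y))
          w A - mvfderiv (𝓡 5) ι w (cov (extend (EuclideanSpace ℝ (Fin 5)) B) w A) =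
        ContinuousMap.toLp (E := ℝ) 2 μ ℝ ⟨h A B, hc A B⟩ := by
    intro A B
    rw [hdd A B, hd, ← map_sub]
    congr 1
    ext x
    simp only [ContinuousMap.sub_apply, ContinuousMap.coe_mk, hh]
  have hNN : ∀ A B C D : TangentSpace (𝓡 5) w,
      ⟪mvfderiv (𝓡 5) (fun y ↦ mvfderiv (𝓡 5) ι y (extend (EuclideanSpace ℝ (Fin 5)) B y))
          w A - mvfderiv (𝓡 5) ι w (cov (extend (EuclideanSpace ℝ (Fin 5)) B) w A),
        mvfderiv (𝓡 5) (fun y ↦ mvfderiv (𝓡 5) ι y (extend (EuclideanSpace ℝ (Fin 5)) D y))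
          w C - mvfderiv (𝓡 5) ι w (cov (extend (EuclideanSpace ℝ (Fin 5)) D) w C)⟫ =
        ∫ x, h A B x * h C D x ∂μ := by
    intro A B C D
    rw [hNv, hNv, inner_toLp_toLp]
    simp only [ContinuousMap.coe_mk]
  have hNd : ∀ A B Z : TangentSpace (𝓡 5) w,
      ⟪mvfderiv (𝓡 5) (fun y ↦ mvfderiv (𝓡 5) ι y (extend (EuclideanSpace ℝ (Fin 5)) B y))
          w A - mvfderiv (𝓡 5) ι w (cov (extend (EuclideanSpace ℝ (Fin 5)) B) w A),
        mvfderiv (𝓡 5) ι w Z⟫ = ∫ x, h A B x * D1 θ w Z x ∂μ := by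
    intro A B Z
    rw [hNv, hd, inner_toLp_toLp]
    simp only [ContinuousMap.coe_mk]
  -- `h A B` is a normal part of the chart Hessian on `(B, A)`
  have hnormal : ∀ A B : TangentSpace (𝓡 5) w, IsNormalPart gN hgN θ w B A (h A B) := by
    intro A B
    refine ⟨⟨cov (extend (EuclideanSpace ℝ (Fin 5)) B) w A, fun x ↦ ?_⟩, fun Z ↦ ?_⟩
    · simp only [hh, sub_sub_cancel]
    · rw [hgi, ← hNd A B Z]
      exact inner_sff_mvfderiv_immersion hcov hι hg w A B Z
  refine ⟨h X X, h Y X, h Y Y, hnormal X X, hnormal Y X, hnormal Y Y, ?_⟩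
  -- the Gauss equation
  change G.val w (cov.curvature w X Y Y) X = _
  rw [val_curvature_immersion hcov hι hg w X Y Y X, sff_symm_immersion hcov hι w X Y, hNN, hNN,
    saddleForm, hgi, hgi]
  exact gauss_algebra _ _ _

end GaussFamily

/-- **K2 (`hellingerGaussEquation`; cards fisher-sphere-gauss K2 = hellinger-gauss-normal-part P2).**
In the situation of stub I, let `G` be the induced metric (`G.val = 𝓘_θ`) and `cov` any Levi-Civita
connection of `G`. Then at every point `w` and for all `X, Y ∈ T_w W` the normal parts
`h_XX, h_XY, h_YY` of the chart Hessian of `θ` (its second fundamental form in flat `L²(N, dvol)`,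
`IsNormalPart`) exist, and the GAUSS EQUATION holds in the tree's convention
`Rm(X,Y,Z,W) = G(R(X,Y)Z, W)`:
  `Rm(X, Y, Y, X) = ⟨h_XX, h_YY⟩_{L²} − ‖h_XY‖²_{L²} = − saddleForm`.
(Levi-Civita of an induced metric = tangential projection of the flat derivative; Gauss 1827, Lee,
*Riemannian Manifolds* 2nd ed. Thm 8.5, carried over to a finite-dimensional immersed submanifold
of the Hilbert space `L²(N, dvol_{g_N})`: `gauss_toLp_family` with `μ` the (finite) Riemannian
measure of the compact `N` on its Borel σ-algebra, for which `gIntegral = ∫ · dμ` by definition.)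
[cite: LeeRiemannianManifolds2018, Thm 8.5; GroisserMurray1997, §2 p. 5] -/
theorem stub_hellingerGaussEquation
    (N : Type) [TopologicalSpace N] [T2Space N] [SecondCountableTopology N] [CompactSpace N]
    [ChartedSpace (EuclideanSpace ℝ (Fin 4)) N] [IsManifold (𝓡 4) ∞ N]
    (gN : PseudoRiemannianMetric (𝓡 4) ∞ (EuclideanSpace ℝ (Fin 4)) (TangentSpace (𝓡 4) : N → Type _))
    (hgN : gN.IsRiemannian)
    (W : Type) [TopologicalSpace W] [T2Space W] [SecondCountableTopology W]
    [ChartedSpace (EuclideanSpace ℝ (Fin 5)) W] [IsManifold (𝓡 5) ∞ W]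
    (θ : W → N → ℝ) (hθ : ContMDiff ((𝓡 5).prod (𝓡 4)) 𝓘(ℝ, ℝ) ∞ (fun p : W × N ↦ θ p.1 p.2))
    (G : PseudoRiemannianMetric (𝓡 5) ∞ (EuclideanSpace ℝ (Fin 5)) (TangentSpace (𝓡 5) : W → Type _))
    (hG : G.IsRiemannian)
    (hGθ : ∀ (w : W) (X Y : TangentSpace (𝓡 5) w), G.val w X Y = fisherForm gN hgN θ w X Y)
    (cov : CovariantDerivative (𝓡 5) (EuclideanSpace ℝ (Fin 5)) (TangentSpace (𝓡 5) : W → Type _))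
    (hcov : G.IsLeviCivita cov) (w : W) (X Y : TangentSpace (𝓡 5) w) :
    ∃ hXX hXY hYY : N → ℝ,
      IsNormalPart gN hgN θ w X X hXX ∧ IsNormalPart gN hgN θ w X Y hXY ∧
      IsNormalPart gN hgN θ w Y Y hYY ∧
      G.curvatureForm cov w X Y Y X = - saddleForm gN hgN hXX hXY hYY := by
  have _ := hG -- the Gauss equation needs no definiteness of `G`
  letI : MeasurableSpace N := borel N
  haveI : BorelSpace N := ⟨rfl⟩
  haveI : IsFiniteMeasure (riemannianMeasure (gN.toContMDiffRiemannianMetric hgN)) :=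
    ⟨Literature.Geometry.Lorentzian.riemannianVolume_lt_top_of_isCompact_holds _ le_rfl
      isCompact_univ⟩
  exact gauss_toLp_family (μ := riemannianMeasure (gN.toContMDiffRiemannianMetric hgN))
    (fun f ↦ rfl) hθ hGθ hcov w X Y

end Summit.SmoothPoincare4.SmoothPoincare4.Cruxes.AhHadamardFilling.FisherSphereGauss

end
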